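import Mathlib
import HarnessLib
import Literature.NumberTheory.LFunctions.TruncatedPoisson
import Literature.Analysis.Fourier.AiryHardyTails

/-!
# Truncated Poisson summation with the trapezoid weight (towards Graham–Kolesnik, Lemma 7.16), PROVED

Topic `Literature/NumberTheory/LFunctions`. The analytic first step of Graham–Kolesnik's Lemma 7.16
(*Van der Corput's Method of Exponential Sums*, LMS LN 126, §7.4, p. 66: "where we have used the
Poisson summation formula in the last line") — Poisson summation for the compactly supported,
continuous, piecewise-`C¹` function `g(x) e(θ(x))`, `g` the trapezoid weight of Lemmas 7.8–7.9
(`Literature.Analysis.Fourier.AiryHardy.trap`, file `AiryHardyTails.lean`) — in the finite,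
truncated form that the tree's Euler–Maclaurin machinery gives
(`Literature.NumberTheory.LFunctions.AFE.norm_sum_Ioc_sub_expansion_le`, Titchmarsh Lemma 4.7,
file `TruncatedPoisson.lean`):

`‖∑_{N<n≤N₁+1} g(n) e(θ(n)) - ∑_{|ν|≤V} ∫_N^{N₁+1} g(x) e(θ(x)) e(νx) dx‖ ≤ (1 + 2πT)(N₁ - N + 7) η_V`

for `0 ≤ N`, `N + 1 ≤ N₁`, `V ≥ 1`, `θ` differentiable with `|θ'| ≤ T` on `[N, N₁ + 1]`
(`CubicSum.trap_expansion`; `η_V = (3 + log(2V+1))/(2V+1) → 0`, `AFE.exists_sawEta_le`). Since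
`g` is continuous and vanishes at `N` and `N₁ + 1`, all boundary terms disappear, exactly as in the
Poisson summation formula; letting `V → ∞` is not needed downstream (one fixes `V` with `η_V`
small).

## Proof

On each of the three affine pieces of `g` the function `φ(x) = (αx + β) e(θ(x))` is `C¹`, and
`AFE.norm_sum_Ioc_sub_expansion_le` gives
`∑_{p<n≤q} φ(n) = ∫φ + ψ(p)φ(p) - ψ(q)φ(q) - ∑_{ν=1}^V (2πiν)⁻¹ (∫φ' e(νx) - ∫φ' e(-νx)) + R`,
`‖R‖ ≤ (1 + 2πT)(q - p + 2)η_V` (`‖φ'‖ ≤ |α| + 2π|αx+β||θ'| ≤ 1 + 2πT`). Integrating the `ν`-terms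
by parts (`integral_deriv_mul_e`) turns this into
`∑ φ(n) = ∫φ + ∑_{ν=1}^V (∫φ e(νx) + ∫φ e(-νx)) + Z_V(p, φ(p)) - Z_V(q, φ(q)) + R` with the boundary
functional `Z_V(x, v) = ψ(x)v + ∑_{ν=1}^V (2πiν)⁻¹(e(νx) - e(-νx))v` (`CubicSum.Z`, linear in `v`;
`CubicSum.piece_expansion`). Summing the three pieces, the `Z`-terms telescope to
`Z_V(N, 0) - Z_V(N₁ + 1, 0) = 0`.

## Main results (namespace `Literature.NumberTheory.LFunctions.CubicSum`; everything PROVED)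

* `Z`, `Z_zero`; `piece_expansion`; `integral_trap_mul_split`, `integral_trap_mul_split₂`,
  `sum_trap_mul_split`; `trap_expansion`.
* Tools: `hasDerivAt_e_comp`, `norm_e_real`, `hasDerivAt_affine_e`, `integral_deriv_mul_e`
  (`∫ φ' e(νx) = [φ e(νx)] - 2πiν ∫ φ e(νx)`).

## References

* S. W. Graham, G. Kolesnik, *Van der Corput's Method of Exponential Sums*, LMS Lecture Note Series
  126, Cambridge Univ. Press 1991 — Lemma 7.16 (proof, p. 66). [GrahamKolesnik1991]
* E. C. Titchmarsh, *The Theory of the Riemann Zeta-Function*, 2nd ed., Oxford 1986 — §4.7,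
  Lemma 4.7 (proof). [Titchmarsh1986]
-/

noncomputable section

open Real Complex MeasureTheory Set intervalIntegral Finset
open Literature.Analysis.Fourier.AiryHardy (trap trap_eq_left trap_eq_mid trap_eq_right continuous_trap)

namespace Literature.NumberTheory.LFunctions
namespace CubicSum

open Literature.NumberTheory.LFunctions.AFE (saw sawEta norm_sum_Ioc_sub_expansion_le sawEta_nonneg)


open Literature.NumberTheory.LFunctions.AFE (saw sawEta norm_sum_Ioc_sub_expansion_le sawEta_nonneg)

/-! ### One affine piece: Euler–Maclaurin–Poisson expansion and integration by parts -/

/-- `e(t) = exp(2πit)` composed with a real phase: derivative. [folklore] -/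
theorem hasDerivAt_e_comp {θ : ℝ → ℝ} {θ' x : ℝ} (h : HasDerivAt θ θ' x) :
    HasDerivAt (fun y : ℝ => Complex.exp (2 * π * I * θ y))
      (2 * π * I * θ' * Complex.exp (2 * π * I * θ x)) x := by
  have h1 : HasDerivAt (fun y : ℝ => 2 * π * I * (θ y : ℂ)) (2 * π * I * θ') x := by
    simpa using (h.ofReal_comp).const_mul (2 * π * I)
  simpa [mul_comm] using h1.cexp

/-- `‖e(t)‖ = 1` for real `t`. [folklore] -/
theorem norm_e_real (t : ℝ) : ‖Complex.exp (2 * π * I * t)‖ = 1 := by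
  have : (2 * π * I * t : ℂ) = ((2 * π * t : ℝ) : ℂ) * I := by push_cast; ring
  rw [this, Complex.norm_exp_ofReal_mul_I]

/-- The affine piece `φ(x) = (αx + β) e(θ(x))` and its derivative. [folklore] -/
theorem hasDerivAt_affine_e {θ θ' : ℝ → ℝ} {α β x : ℝ} (h : HasDerivAt θ (θ' x) x) :
    HasDerivAt (fun y : ℝ => ((α * y + β : ℝ) : ℂ) * Complex.exp (2 * π * I * θ y))
      ((α : ℂ) * Complex.exp (2 * π * I * θ x)
        + ((α * x + β : ℝ) : ℂ) * (2 * π * I * θ' x * Complex.exp (2 * π * I * θ x))) x := by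
  have hw : HasDerivAt (fun y : ℝ => ((α * y + β : ℝ) : ℂ)) (α : ℂ) x := by
    have h1 : HasDerivAt (fun y : ℝ => α * y + β) (α * 1) x := ((hasDerivAt_id x).const_mul α).add_const β
    simpa using h1.ofReal_comp
  exact hw.mul (hasDerivAt_e_comp h)

/-- **Integration by parts against `e(νx)`** on a piece: for `φ` with continuous derivative `φ'` on
`[p, q]`, `∫_p^q φ'(x) e(νx) dx = φ(q)e(νq) - φ(p)e(νp) - 2πiν ∫_p^q φ(x) e(νx) dx`. [folklore] -/
theorem integral_deriv_mul_e {φ φ' : ℝ → ℂ} {p q : ℝ} (hpq : p ≤ q) (ν : ℝ)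
    (hφ : ∀ x ∈ Icc p q, HasDerivAt φ (φ' x) x) (hφ'c : ContinuousOn φ' (Icc p q)) :
    ∫ x in p..q, φ' x * Complex.exp (2 * π * I * ν * x) =
      φ q * Complex.exp (2 * π * I * ν * q) - φ p * Complex.exp (2 * π * I * ν * p)
        - 2 * π * I * ν * ∫ x in p..q, φ x * Complex.exp (2 * π * I * ν * x) := by
  have huIcc : uIcc p q = Icc p q := uIcc_of_le hpq
  have hφc : ContinuousOn φ (Icc p q) := fun x hx => (hφ x hx).continuousAt.continuousWithinAt
  have hE : ∀ x : ℝ, HasDerivAt (fun y : ℝ => Complex.exp (2 * π * I * ν * y))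
      (2 * π * I * ν * Complex.exp (2 * π * I * ν * x)) x := by
    intro x
    have h := hasDerivAt_e_comp (θ := fun y => ν * y) (((hasDerivAt_id x).const_mul ν))
    simp only [mul_one] at h
    have e1 : (fun y : ℝ => Complex.exp (2 * π * I * ((ν * y : ℝ) : ℂ))) =
        fun y : ℝ => Complex.exp (2 * π * I * ν * y) := by
      funext y; push_cast; ring_nf
    have e2 : 2 * π * I * (ν : ℂ) * Complex.exp (2 * π * I * ((ν * x : ℝ) : ℂ)) =
        2 * π * I * ν * Complex.exp (2 * π * I * ν * x) := by push_cast; ring_nf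
    rw [e1, e2] at h
    exact h
  have hEc : Continuous (fun y : ℝ => Complex.exp (2 * π * I * ν * y)) := by fun_prop
  have hprod : ∀ x ∈ Icc p q, HasDerivAt (fun y => φ y * Complex.exp (2 * π * I * ν * y))
      (φ' x * Complex.exp (2 * π * I * ν * x) + φ x * (2 * π * I * ν * Complex.exp (2 * π * I * ν * x))) x :=
    fun x hx => (hφ x hx).mul (hE x)
  have hi1 : IntervalIntegrable (fun x => φ' x * Complex.exp (2 * π * I * ν * x)) volume p q :=
    (hφ'c.mul hEc.continuousOn).intervalIntegrable_of_Icc hpq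
  have hi2 : IntervalIntegrable (fun x => φ x * (2 * π * I * ν * Complex.exp (2 * π * I * ν * x))) volume p q :=
    (hφc.mul (continuousOn_const.mul hEc.continuousOn)).intervalIntegrable_of_Icc hpq
  have hftc := intervalIntegral.integral_eq_sub_of_hasDerivAt
    (fun x hx => hprod x (by rwa [huIcc] at hx)) (hi1.add hi2)
  rw [intervalIntegral.integral_add hi1 hi2] at hftc
  have e3 : ∫ x in p..q, φ x * (2 * π * I * ν * Complex.exp (2 * π * I * ν * x)) =
      2 * π * I * ν * ∫ x in p..q, φ x * Complex.exp (2 * π * I * ν * x) := by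
    rw [← intervalIntegral.integral_const_mul]
    refine intervalIntegral.integral_congr fun x _ => ?_; ring
  rw [e3] at hftc
  linear_combination hftc


/-! ### The boundary functional `Z_V` -/

/-- `Z_V(x, v) = ψ(x) v + ∑_{ν=1}^V (1/(2πiν)) (e(νx) - e(-νx)) v`: the boundary functional of the
truncated Euler–Maclaurin–Poisson expansion after integrating by parts; it is linear in `v`, so the
boundary contributions of adjacent pieces of a continuous function cancel. [folklore] -/
def Z (V : ℕ) (x : ℝ) (v : ℂ) : ℂ :=
  (saw x : ℂ) * v + ∑ ν ∈ Finset.Icc 1 V, (1 / (2 * π * I * ν)) *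
    (Complex.exp (2 * π * I * ν * x) - Complex.exp (-(2 * π * I * ν * x))) * v

/-- `Z_V(x, 0) = 0`. [folklore] -/
theorem Z_zero (V : ℕ) (x : ℝ) : Z V x 0 = 0 := by simp [Z]

/-! ### One affine piece -/

/-- **Expansion of one affine piece.** For `0 ≤ p ≤ q`, `V ≥ 1`, `φ(x) = (αx + β) e(θ(x))` with
`|αx + β| ≤ 1`, `|α| ≤ 1` on `[p, q]` and `|θ'| ≤ T` there:
`∑_{p<n≤q} φ(n) = A(0) + ∑_{ν=1}^V (A(ν) + A(-ν)) + Z_V(p, φ(p)) - Z_V(q, φ(q)) + R`,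
`A(ν) = ∫_p^q φ(x) e(νx) dx`, `‖R‖ ≤ (1 + 2πT)(q - p + 2) η_V`.
[cite: Titchmarsh1986, Lemma 4.7 (proof); GrahamKolesnik1991, Lemma 7.16 (proof, "Poisson summation")] -/
theorem piece_expansion {θ θ' : ℝ → ℝ} {p q α β T : ℝ} {V : ℕ} (hp : 0 ≤ p) (hpq : p ≤ q) (hV : 1 ≤ V)
    (hθ : ∀ x ∈ Icc p q, HasDerivAt θ (θ' x) x) (hθ'c : ContinuousOn θ' (Icc p q))
    (hT : ∀ x ∈ Icc p q, |θ' x| ≤ T) (hw : ∀ x ∈ Icc p q, |α * x + β| ≤ 1) (hα : |α| ≤ 1) :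
    ‖(∑ n ∈ Finset.Ioc ⌊p⌋₊ ⌊q⌋₊, ((α * n + β : ℝ) : ℂ) * Complex.exp (2 * π * I * θ n))
        - ((∫ x in p..q, ((α * x + β : ℝ) : ℂ) * Complex.exp (2 * π * I * θ x))
          + ∑ ν ∈ Finset.Icc 1 V,
            ((∫ x in p..q, ((α * x + β : ℝ) : ℂ) * Complex.exp (2 * π * I * θ x) * Complex.exp (2 * π * I * ν * x))
              + ∫ x in p..q, ((α * x + β : ℝ) : ℂ) * Complex.exp (2 * π * I * θ x) * Complex.exp (-(2 * π * I * ν * x))))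
        - (Z V p (((α * p + β : ℝ) : ℂ) * Complex.exp (2 * π * I * θ p))
          - Z V q (((α * q + β : ℝ) : ℂ) * Complex.exp (2 * π * I * θ q)))‖
      ≤ (1 + 2 * π * T) * (q - p + 2) * sawEta V := by
  -- the piece and its derivative
  set φ : ℝ → ℂ := fun x => ((α * x + β : ℝ) : ℂ) * Complex.exp (2 * π * I * θ x) with hφ
  set φ' : ℝ → ℂ := fun x => (α : ℂ) * Complex.exp (2 * π * I * θ x)
    + ((α * x + β : ℝ) : ℂ) * (2 * π * I * θ' x * Complex.exp (2 * π * I * θ x)) with hφ'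
  have hφd : ∀ x ∈ Icc p q, HasDerivAt φ (φ' x) x := fun x hx => hasDerivAt_affine_e (hθ x hx)
  have hθc : ContinuousOn θ (Icc p q) := fun x hx => (hθ x hx).continuousAt.continuousWithinAt
  have hec : ContinuousOn (fun x => Complex.exp (2 * π * I * θ x)) (Icc p q) :=
    Complex.continuous_exp.comp_continuousOn (continuousOn_const.mul
      (Complex.continuous_ofReal.comp_continuousOn hθc))
  have hφ'c : ContinuousOn φ' (Icc p q) := by
    refine (continuousOn_const.mul hec).add ((Complex.continuous_ofReal.comp_continuousOn
      (Continuous.continuousOn (by fun_prop))).mul ((continuousOn_const.mul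
        (Complex.continuous_ofReal.comp_continuousOn hθ'c)).mul hec))
  have hT0 : 0 ≤ T := (abs_nonneg _).trans (hT p (left_mem_Icc.2 hpq))
  have hΦ : ∀ x ∈ Icc p q, ‖φ' x‖ ≤ 1 + 2 * π * T := by
    intro x hx
    simp only [hφ']
    refine (norm_add_le _ _).trans (add_le_add ?_ ?_)
    · rw [norm_mul, norm_e_real, mul_one, Complex.norm_real, Real.norm_eq_abs]; exact hα
    · rw [norm_mul, norm_mul, norm_e_real, mul_one, Complex.norm_real, Real.norm_eq_abs]
      have h2 : ‖(2 * π * I * (θ' x : ℂ))‖ = 2 * π * |θ' x| := by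
        rw [norm_mul, norm_mul, norm_mul, Complex.norm_I, mul_one, Complex.norm_real, Complex.norm_two,
          Complex.norm_real, Real.norm_eq_abs, Real.norm_eq_abs, abs_of_pos Real.pi_pos]
      rw [h2]
      calc |α * x + β| * (2 * π * |θ' x|) ≤ 1 * (2 * π * T) := by
            refine mul_le_mul (hw x hx) ?_ (by positivity) zero_le_one
            exact mul_le_mul_of_nonneg_left (hT x hx) (by positivity)
        _ = 2 * π * T := one_mul _
  have hAFE := norm_sum_Ioc_sub_expansion_le hp hpq hV hφd hφ'c hΦ
  -- integrate the `ν`-terms by parts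
  have hibp : ∀ ν : ℕ, (∫ x in p..q, φ' x * Complex.exp (2 * π * I * ν * x)) =
      φ q * Complex.exp (2 * π * I * ν * q) - φ p * Complex.exp (2 * π * I * ν * p)
        - 2 * π * I * ν * ∫ x in p..q, φ x * Complex.exp (2 * π * I * ν * x) := by
    intro ν
    have := integral_deriv_mul_e hpq (ν : ℝ) hφd hφ'c
    push_cast at this ⊢
    exact this
  have hibp' : ∀ ν : ℕ, (∫ x in p..q, φ' x * Complex.exp (-(2 * π * I * ν * x))) =
      φ q * Complex.exp (-(2 * π * I * ν * q)) - φ p * Complex.exp (-(2 * π * I * ν * p))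
        + 2 * π * I * ν * ∫ x in p..q, φ x * Complex.exp (-(2 * π * I * ν * x)) := by
    intro ν
    have h := integral_deriv_mul_e hpq (-(ν : ℝ)) hφd hφ'c
    have e1 : ∀ x : ℝ, Complex.exp (2 * π * I * ((-(ν : ℝ) : ℝ) : ℂ) * x) = Complex.exp (-(2 * π * I * ν * x)) := by
      intro x; congr 1; push_cast; ring
    simp only [e1] at h
    rw [h]
    push_cast
    ring
  -- the identity between the two expansions
  have hid : ((∫ x in p..q, φ x) + (saw p : ℂ) * φ p - (saw q : ℂ) * φ q
      - ∑ ν ∈ Finset.Icc 1 V, (1 / (2 * π * I * ν)) *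
        ((∫ x in p..q, φ' x * Complex.exp (2 * π * I * ν * x))
          - ∫ x in p..q, φ' x * Complex.exp (-(2 * π * I * ν * x))))
      = ((∫ x in p..q, φ x)
          + ∑ ν ∈ Finset.Icc 1 V,
            ((∫ x in p..q, φ x * Complex.exp (2 * π * I * ν * x))
              + ∫ x in p..q, φ x * Complex.exp (-(2 * π * I * ν * x))))
        + (Z V p (φ p) - Z V q (φ q)) := by
    simp only [Z, hibp, hibp']
    have hνne : ∀ ν ∈ Finset.Icc 1 V, (2 * π * I * (ν : ℂ)) ≠ 0 := by
      intro ν hν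
      have : (1 : ℕ) ≤ ν := (Finset.mem_Icc.1 hν).1
      have hν0 : (ν : ℂ) ≠ 0 := by exact_mod_cast (by omega : ν ≠ 0)
      exact mul_ne_zero (mul_ne_zero (mul_ne_zero two_ne_zero (by exact_mod_cast Real.pi_ne_zero))
        Complex.I_ne_zero) hν0
    -- termwise: `T_ν = -(A ν + A(-ν)) - P_ν + Q_ν`
    have key : ∀ ν ∈ Finset.Icc 1 V,
        (1 / (2 * π * I * ν)) *
          ((φ q * Complex.exp (2 * π * I * ν * q) - φ p * Complex.exp (2 * π * I * ν * p)
              - 2 * π * I * ν * ∫ x in p..q, φ x * Complex.exp (2 * π * I * ν * x))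
            - (φ q * Complex.exp (-(2 * π * I * ν * q)) - φ p * Complex.exp (-(2 * π * I * ν * p))
              + 2 * π * I * ν * ∫ x in p..q, φ x * Complex.exp (-(2 * π * I * ν * x))))
        = -((∫ x in p..q, φ x * Complex.exp (2 * π * I * ν * x))
              + ∫ x in p..q, φ x * Complex.exp (-(2 * π * I * ν * x)))
          - (1 / (2 * π * I * ν)) *
              (Complex.exp (2 * π * I * ν * p) - Complex.exp (-(2 * π * I * ν * p))) * φ p
          + (1 / (2 * π * I * ν)) *
              (Complex.exp (2 * π * I * ν * q) - Complex.exp (-(2 * π * I * ν * q))) * φ q := by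
      intro ν hν
      have h1 := hνne ν hν
      have h2 : (ν : ℂ) ≠ 0 := by
        intro h0; apply h1; rw [h0, mul_zero]
      field_simp
      ring
    rw [Finset.sum_congr rfl key, Finset.sum_add_distrib, Finset.sum_sub_distrib, Finset.sum_neg_distrib]
    ring
  -- conclude
  rw [hid] at hAFE
  refine (Eq.trans_le ?_ hAFE)
  congr 1
  simp only [hφ]
  ring


/-! ### The trapezoid: three pieces -/

/-- Splitting `∫_N^{N₁+1} g·F` into the three affine pieces (for continuous `F`). [folklore] -/
theorem integral_trap_mul_split {F : ℝ → ℂ} {N N₁ : ℝ} (hN : N + 1 ≤ N₁)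
    (hF : ContinuousOn F (Icc N (N₁ + 1))) :
    ∫ x in N..(N₁ + 1), (trap N N₁ x : ℂ) * F x =
      (∫ x in N..(N + 1), ((1 * x + -N : ℝ) : ℂ) * F x)
      + (∫ x in (N + 1)..N₁, ((0 * x + 1 : ℝ) : ℂ) * F x)
      + ∫ x in N₁..(N₁ + 1), ((-1 * x + (N₁ + 1) : ℝ) : ℂ) * F x := by
  have hgc : ContinuousOn (fun x => (trap N N₁ x : ℂ) * F x) (Icc N (N₁ + 1)) :=
    (Complex.continuous_ofReal.comp (continuous_trap N N₁)).continuousOn.mul hF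
  have hi : ∀ p ∈ Icc N (N₁ + 1), ∀ q ∈ Icc N (N₁ + 1), IntervalIntegrable
      (fun x => (trap N N₁ x : ℂ) * F x) volume p q :=
    fun p hp q hq => (hgc.mono (uIcc_subset_Icc hp hq)).intervalIntegrable
  have h1I : N ∈ Icc N (N₁ + 1) := left_mem_Icc.2 (by linarith)
  have h2I : N + 1 ∈ Icc N (N₁ + 1) := ⟨by linarith, by linarith⟩
  have h3I : N₁ ∈ Icc N (N₁ + 1) := ⟨by linarith, by linarith⟩
  have h4I : N₁ + 1 ∈ Icc N (N₁ + 1) := right_mem_Icc.2 (by linarith)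
  have h1 := intervalIntegral.integral_add_adjacent_intervals (hi N h1I (N + 1) h2I) (hi (N + 1) h2I (N₁ + 1) h4I)
  have h2 := intervalIntegral.integral_add_adjacent_intervals (hi (N + 1) h2I N₁ h3I) (hi N₁ h3I (N₁ + 1) h4I)
  have hp1 : ∫ x in N..(N + 1), (trap N N₁ x : ℂ) * F x = ∫ x in N..(N + 1), ((1 * x + -N : ℝ) : ℂ) * F x := by
    refine intervalIntegral.integral_congr fun x hx => ?_
    rw [Set.uIcc_of_le (by linarith)] at hx
    simp only [trap_eq_left hN hx]; push_cast; ring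
  have hp2 : ∫ x in (N + 1)..N₁, (trap N N₁ x : ℂ) * F x = ∫ x in (N + 1)..N₁, ((0 * x + 1 : ℝ) : ℂ) * F x := by
    refine intervalIntegral.integral_congr fun x hx => ?_
    rw [Set.uIcc_of_le hN] at hx
    simp only [trap_eq_mid hx]; push_cast; ring
  have hp3 : ∫ x in N₁..(N₁ + 1), (trap N N₁ x : ℂ) * F x =
      ∫ x in N₁..(N₁ + 1), ((-1 * x + (N₁ + 1) : ℝ) : ℂ) * F x := by
    refine intervalIntegral.integral_congr fun x hx => ?_
    rw [Set.uIcc_of_le (by linarith)] at hx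
    simp only [trap_eq_right hN hx]; push_cast; ring
  rw [← h1, ← h2, hp1, hp2, hp3]
  ring

/-- Splitting `∫_N^{N₁+1} g·E·X` into the three affine pieces (for continuous `E`, `X`). [folklore] -/
theorem integral_trap_mul_split₂ {E X : ℝ → ℂ} {N N₁ : ℝ} (hN : N + 1 ≤ N₁)
    (hE : ContinuousOn E (Icc N (N₁ + 1))) (hX : ContinuousOn X (Icc N (N₁ + 1))) :
    ∫ x in N..(N₁ + 1), (trap N N₁ x : ℂ) * E x * X x =
      (∫ x in N..(N + 1), ((1 * x + -N : ℝ) : ℂ) * E x * X x)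
      + (∫ x in (N + 1)..N₁, ((0 * x + 1 : ℝ) : ℂ) * E x * X x)
      + ∫ x in N₁..(N₁ + 1), ((-1 * x + (N₁ + 1) : ℝ) : ℂ) * E x * X x := by
  have hgc : ContinuousOn (fun x => (trap N N₁ x : ℂ) * E x * X x) (Icc N (N₁ + 1)) :=
    ((Complex.continuous_ofReal.comp (continuous_trap N N₁)).continuousOn.mul hE).mul hX
  have hi : ∀ p ∈ Icc N (N₁ + 1), ∀ q ∈ Icc N (N₁ + 1), IntervalIntegrable
      (fun x => (trap N N₁ x : ℂ) * E x * X x) volume p q :=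
    fun p hp q hq => (hgc.mono (uIcc_subset_Icc hp hq)).intervalIntegrable
  have h1I : N ∈ Icc N (N₁ + 1) := left_mem_Icc.2 (by linarith)
  have h2I : N + 1 ∈ Icc N (N₁ + 1) := ⟨by linarith, by linarith⟩
  have h3I : N₁ ∈ Icc N (N₁ + 1) := ⟨by linarith, by linarith⟩
  have h4I : N₁ + 1 ∈ Icc N (N₁ + 1) := right_mem_Icc.2 (by linarith)
  have h1 := intervalIntegral.integral_add_adjacent_intervals (hi N h1I (N + 1) h2I) (hi (N + 1) h2I (N₁ + 1) h4I)
  have h2 := intervalIntegral.integral_add_adjacent_intervals (hi (N + 1) h2I N₁ h3I) (hi N₁ h3I (N₁ + 1) h4I)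
  have hp1 : ∫ x in N..(N + 1), (trap N N₁ x : ℂ) * E x * X x = ∫ x in N..(N + 1), ((1 * x + -N : ℝ) : ℂ) * E x * X x := by
    refine intervalIntegral.integral_congr fun x hx => ?_
    rw [Set.uIcc_of_le (by linarith)] at hx
    simp only [trap_eq_left hN hx]; push_cast; ring
  have hp2 : ∫ x in (N + 1)..N₁, (trap N N₁ x : ℂ) * E x * X x = ∫ x in (N + 1)..N₁, ((0 * x + 1 : ℝ) : ℂ) * E x * X x := by
    refine intervalIntegral.integral_congr fun x hx => ?_
    rw [Set.uIcc_of_le hN] at hx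
    simp only [trap_eq_mid hx]; push_cast; ring
  have hp3 : ∫ x in N₁..(N₁ + 1), (trap N N₁ x : ℂ) * E x * X x =
      ∫ x in N₁..(N₁ + 1), ((-1 * x + (N₁ + 1) : ℝ) : ℂ) * E x * X x := by
    refine intervalIntegral.integral_congr fun x hx => ?_
    rw [Set.uIcc_of_le (by linarith)] at hx
    simp only [trap_eq_right hN hx]; push_cast; ring
  rw [← h1, ← h2, hp1, hp2, hp3]
  ring

/-- Splitting the sum `∑_{N<n≤N₁+1} g(n) f(n)` into the three ranges. [folklore] -/
theorem sum_trap_mul_split (f : ℕ → ℂ) {N N₁ : ℝ} (hN0 : 0 ≤ N) (hN : N + 1 ≤ N₁) :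
    ∑ n ∈ Finset.Ioc ⌊N⌋₊ ⌊N₁ + 1⌋₊, (trap N N₁ n : ℂ) * f n =
      (∑ n ∈ Finset.Ioc ⌊N⌋₊ ⌊N + 1⌋₊, ((1 * n + -N : ℝ) : ℂ) * f n)
      + (∑ n ∈ Finset.Ioc ⌊N + 1⌋₊ ⌊N₁⌋₊, ((0 * n + 1 : ℝ) : ℂ) * f n)
      + ∑ n ∈ Finset.Ioc ⌊N₁⌋₊ ⌊N₁ + 1⌋₊, ((-1 * n + (N₁ + 1) : ℝ) : ℂ) * f n := by
  have hm1 : ⌊N⌋₊ ≤ ⌊N + 1⌋₊ := Nat.floor_mono (by linarith)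
  have hm2 : ⌊N + 1⌋₊ ≤ ⌊N₁⌋₊ := Nat.floor_mono hN
  have hm3 : ⌊N₁⌋₊ ≤ ⌊N₁ + 1⌋₊ := Nat.floor_mono (by linarith)
  have hmem : ∀ {p q : ℝ} {n : ℕ}, 0 ≤ p → n ∈ Finset.Ioc ⌊p⌋₊ ⌊q⌋₊ → (n : ℝ) ∈ Icc p q := by
    intro p q n hp hn
    rw [Finset.mem_Ioc] at hn
    have h1 : p < n := (Nat.floor_lt hp).1 hn.1
    have h2 : (n : ℝ) ≤ q := by
      have hq : 0 ≤ q := by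
        by_contra hq
        have : ⌊q⌋₊ = 0 := Nat.floor_eq_zero.2 (by linarith [not_le.1 hq])
        omega
      exact (Nat.le_floor_iff hq).1 hn.2
    exact ⟨h1.le, h2⟩
  have h1 := Finset.sum_Ioc_consecutive (fun n : ℕ => (trap N N₁ n : ℂ) * f n) hm1 (hm2.trans hm3)
  have h2 := Finset.sum_Ioc_consecutive (fun n : ℕ => (trap N N₁ n : ℂ) * f n) hm2 hm3
  have hp1 : ∑ n ∈ Finset.Ioc ⌊N⌋₊ ⌊N + 1⌋₊, (trap N N₁ n : ℂ) * f n =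
      ∑ n ∈ Finset.Ioc ⌊N⌋₊ ⌊N + 1⌋₊, ((1 * n + -N : ℝ) : ℂ) * f n := by
    refine Finset.sum_congr rfl fun n hn => ?_
    rw [trap_eq_left hN (hmem hN0 hn)]; push_cast; ring
  have hp2 : ∑ n ∈ Finset.Ioc ⌊N + 1⌋₊ ⌊N₁⌋₊, (trap N N₁ n : ℂ) * f n =
      ∑ n ∈ Finset.Ioc ⌊N + 1⌋₊ ⌊N₁⌋₊, ((0 * n + 1 : ℝ) : ℂ) * f n := by
    refine Finset.sum_congr rfl fun n hn => ?_
    rw [trap_eq_mid (hmem (by linarith) hn)]; push_cast; ring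
  have hp3 : ∑ n ∈ Finset.Ioc ⌊N₁⌋₊ ⌊N₁ + 1⌋₊, (trap N N₁ n : ℂ) * f n =
      ∑ n ∈ Finset.Ioc ⌊N₁⌋₊ ⌊N₁ + 1⌋₊, ((-1 * n + (N₁ + 1) : ℝ) : ℂ) * f n := by
    refine Finset.sum_congr rfl fun n hn => ?_
    rw [trap_eq_right hN (hmem (by linarith) hn)]; push_cast; ring
  rw [← h1, ← h2, hp1, hp2, hp3]
  ring

/-- **Truncated Poisson summation for the trapezoid weight.** For `0 ≤ N`, `N + 1 ≤ N₁`, `V ≥ 1` and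
a phase `θ` with `|θ'| ≤ T` on `[N, N₁ + 1]`:
`‖∑_{N<n≤N₁+1} g(n) e(θ(n)) - ∑_{|ν|≤V} ∫_N^{N₁+1} g(x) e(θ(x) + νx) dx‖ ≤ (1 + 2πT)(N₁ - N + 7) η_V`
(`η_V → 0`), the boundary terms of the three pieces cancelling because `g` is continuous and vanishes
at `N` and `N₁ + 1`. [cite: GrahamKolesnik1991, Lemma 7.16 (proof, "we have used the Poisson summation formula")] -/
theorem trap_expansion {θ θ' : ℝ → ℝ} {N N₁ T : ℝ} {V : ℕ} (hN0 : 0 ≤ N) (hN : N + 1 ≤ N₁) (hV : 1 ≤ V)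
    (hθ : ∀ x ∈ Icc N (N₁ + 1), HasDerivAt θ (θ' x) x) (hθ'c : ContinuousOn θ' (Icc N (N₁ + 1)))
    (hT : ∀ x ∈ Icc N (N₁ + 1), |θ' x| ≤ T) :
    ‖(∑ n ∈ Finset.Ioc ⌊N⌋₊ ⌊N₁ + 1⌋₊, (trap N N₁ n : ℂ) * Complex.exp (2 * π * I * θ n))
        - ((∫ x in N..(N₁ + 1), (trap N N₁ x : ℂ) * Complex.exp (2 * π * I * θ x))
          + ∑ ν ∈ Finset.Icc 1 V,
            ((∫ x in N..(N₁ + 1), (trap N N₁ x : ℂ) * Complex.exp (2 * π * I * θ x) * Complex.exp (2 * π * I * ν * x))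
              + ∫ x in N..(N₁ + 1), (trap N N₁ x : ℂ) * Complex.exp (2 * π * I * θ x) * Complex.exp (-(2 * π * I * ν * x))))‖
      ≤ (1 + 2 * π * T) * (N₁ - N + 7) * sawEta V := by
  have hs1 : Icc N (N + 1) ⊆ Icc N (N₁ + 1) := Icc_subset_Icc le_rfl (by linarith)
  have hs2 : Icc (N + 1) N₁ ⊆ Icc N (N₁ + 1) := Icc_subset_Icc (by linarith) (by linarith)
  have hs3 : Icc N₁ (N₁ + 1) ⊆ Icc N (N₁ + 1) := Icc_subset_Icc (by linarith) le_rfl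
  -- the three piece expansions
  have hE1 := piece_expansion (α := 1) (β := -N) hN0 (by linarith : N ≤ N + 1) hV
    (fun x hx => hθ x (hs1 hx)) (hθ'c.mono hs1) (fun x hx => hT x (hs1 hx))
    (fun x hx => by rw [abs_le]; constructor <;> linarith [hx.1, hx.2]) (by norm_num)
  have hE2 := piece_expansion (α := 0) (β := 1) (by linarith : 0 ≤ N + 1) hN hV
    (fun x hx => hθ x (hs2 hx)) (hθ'c.mono hs2) (fun x hx => hT x (hs2 hx))
    (fun x hx => by norm_num) (by norm_num)
  have hE3 := piece_expansion (α := -1) (β := N₁ + 1) (by linarith : 0 ≤ N₁) (by linarith : N₁ ≤ N₁ + 1) hV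
    (fun x hx => hθ x (hs3 hx)) (hθ'c.mono hs3) (fun x hx => hT x (hs3 hx))
    (fun x hx => by rw [abs_le]; constructor <;> linarith [hx.1, hx.2]) (by norm_num)
  -- continuity of the factors
  have hθc : ContinuousOn θ (Icc N (N₁ + 1)) := fun x hx => (hθ x hx).continuousAt.continuousWithinAt
  have hec : ContinuousOn (fun x => Complex.exp (2 * π * I * θ x)) (Icc N (N₁ + 1)) :=
    Complex.continuous_exp.comp_continuousOn (continuousOn_const.mul
      (Complex.continuous_ofReal.comp_continuousOn hθc))
  have heνc : ∀ s : ℂ, Continuous (fun x : ℝ => Complex.exp (s * x)) := fun s => by fun_prop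
  -- splitting the sum and the integrals
  have hS := sum_trap_mul_split (fun n : ℕ => Complex.exp (2 * π * I * θ n)) hN0 hN
  have hI0 := integral_trap_mul_split hN hec
  have heθν : ∀ ν : ℕ, ContinuousOn (fun x : ℝ => Complex.exp (2 * π * I * ν * x)) (Icc N (N₁ + 1)) :=
    fun ν => Continuous.continuousOn (by fun_prop)
  have heθν' : ∀ ν : ℕ, ContinuousOn (fun x : ℝ => Complex.exp (-(2 * π * I * ν * x))) (Icc N (N₁ + 1)) :=
    fun ν => Continuous.continuousOn (by fun_prop)
  have hIp := fun ν : ℕ => integral_trap_mul_split₂ hN hec (heθν ν)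
  have hIm := fun ν : ℕ => integral_trap_mul_split₂ hN hec (heθν' ν)
  -- the `M`-terms split
  set M1 := (∫ x in N..(N + 1), ((1 * x + -N : ℝ) : ℂ) * Complex.exp (2 * π * I * θ x))
    + ∑ ν ∈ Finset.Icc 1 V,
      ((∫ x in N..(N + 1), ((1 * x + -N : ℝ) : ℂ) * Complex.exp (2 * π * I * θ x) * Complex.exp (2 * π * I * ν * x))
        + ∫ x in N..(N + 1), ((1 * x + -N : ℝ) : ℂ) * Complex.exp (2 * π * I * θ x) * Complex.exp (-(2 * π * I * ν * x)))
    with hM1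
  set M2 := (∫ x in (N + 1)..N₁, ((0 * x + 1 : ℝ) : ℂ) * Complex.exp (2 * π * I * θ x))
    + ∑ ν ∈ Finset.Icc 1 V,
      ((∫ x in (N + 1)..N₁, ((0 * x + 1 : ℝ) : ℂ) * Complex.exp (2 * π * I * θ x) * Complex.exp (2 * π * I * ν * x))
        + ∫ x in (N + 1)..N₁, ((0 * x + 1 : ℝ) : ℂ) * Complex.exp (2 * π * I * θ x) * Complex.exp (-(2 * π * I * ν * x)))
    with hM2
  set M3 := (∫ x in N₁..(N₁ + 1), ((-1 * x + (N₁ + 1) : ℝ) : ℂ) * Complex.exp (2 * π * I * θ x))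
    + ∑ ν ∈ Finset.Icc 1 V,
      ((∫ x in N₁..(N₁ + 1), ((-1 * x + (N₁ + 1) : ℝ) : ℂ) * Complex.exp (2 * π * I * θ x) * Complex.exp (2 * π * I * ν * x))
        + ∫ x in N₁..(N₁ + 1), ((-1 * x + (N₁ + 1) : ℝ) : ℂ) * Complex.exp (2 * π * I * θ x) * Complex.exp (-(2 * π * I * ν * x)))
    with hM3
  have hM : (∫ x in N..(N₁ + 1), (trap N N₁ x : ℂ) * Complex.exp (2 * π * I * θ x))
      + ∑ ν ∈ Finset.Icc 1 V,
        ((∫ x in N..(N₁ + 1), (trap N N₁ x : ℂ) * Complex.exp (2 * π * I * θ x) * Complex.exp (2 * π * I * ν * x))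
          + ∫ x in N..(N₁ + 1), (trap N N₁ x : ℂ) * Complex.exp (2 * π * I * θ x) * Complex.exp (-(2 * π * I * ν * x)))
      = M1 + M2 + M3 := by
    rw [hI0]
    simp only [hIp, hIm]
    rw [hM1, hM2, hM3]
    simp only [Finset.sum_add_distrib]
    ring
  -- the boundary terms cancel
  have hZ : (Z V N (((1 * N + -N : ℝ) : ℂ) * Complex.exp (2 * π * I * θ N))
        - Z V (N + 1) (((1 * (N + 1) + -N : ℝ) : ℂ) * Complex.exp (2 * π * I * θ (N + 1))))
      + (Z V (N + 1) (((0 * (N + 1) + 1 : ℝ) : ℂ) * Complex.exp (2 * π * I * θ (N + 1)))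
        - Z V N₁ (((0 * N₁ + 1 : ℝ) : ℂ) * Complex.exp (2 * π * I * θ N₁)))
      + (Z V N₁ (((-1 * N₁ + (N₁ + 1) : ℝ) : ℂ) * Complex.exp (2 * π * I * θ N₁))
        - Z V (N₁ + 1) (((-1 * (N₁ + 1) + (N₁ + 1) : ℝ) : ℂ) * Complex.exp (2 * π * I * θ (N₁ + 1)))) = 0 := by
    have e1 : ((1 * N + -N : ℝ) : ℂ) * Complex.exp (2 * π * I * θ N) = 0 := by push_cast; ring
    have e2 : ((1 * (N + 1) + -N : ℝ) : ℂ) = ((0 * (N + 1) + 1 : ℝ) : ℂ) := by push_cast; ring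
    have e3 : ((0 * N₁ + 1 : ℝ) : ℂ) = ((-1 * N₁ + (N₁ + 1) : ℝ) : ℂ) := by push_cast; ring
    have e4 : ((-1 * (N₁ + 1) + (N₁ + 1) : ℝ) : ℂ) * Complex.exp (2 * π * I * θ (N₁ + 1)) = 0 := by
      push_cast; ring
    rw [e1, e2, e3, e4, Z_zero, Z_zero]
    ring
  -- assemble
  rw [hS, hM]
  set S1 := ∑ n ∈ Finset.Ioc ⌊N⌋₊ ⌊N + 1⌋₊, ((1 * n + -N : ℝ) : ℂ) * Complex.exp (2 * π * I * θ n) with hS1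
  set S2 := ∑ n ∈ Finset.Ioc ⌊N + 1⌋₊ ⌊N₁⌋₊, ((0 * n + 1 : ℝ) : ℂ) * Complex.exp (2 * π * I * θ n) with hS2
  set S3 := ∑ n ∈ Finset.Ioc ⌊N₁⌋₊ ⌊N₁ + 1⌋₊, ((-1 * n + (N₁ + 1) : ℝ) : ℂ) * Complex.exp (2 * π * I * θ n) with hS3
  have key : ∀ (Z1 Z1' Z2 Z2' Z3 Z3' : ℂ), (Z1 - Z1') + (Z2 - Z2') + (Z3 - Z3') = 0 →
      S1 + S2 + S3 - (M1 + M2 + M3) =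
        (S1 - M1 - (Z1 - Z1')) + (S2 - M2 - (Z2 - Z2')) + (S3 - M3 - (Z3 - Z3')) := by
    intro Z1 Z1' Z2 Z2' Z3 Z3' h
    linear_combination h
  rw [key _ _ _ _ _ _ hZ]
  refine (norm_add₃_le).trans ?_
  have htot : (1 + 2 * π * T) * (N + 1 - N + 2) * sawEta V + (1 + 2 * π * T) * (N₁ - (N + 1) + 2) * sawEta V
      + (1 + 2 * π * T) * (N₁ + 1 - N₁ + 2) * sawEta V = (1 + 2 * π * T) * (N₁ - N + 7) * sawEta V := by ring
  rw [← htot]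
  exact add_le_add (add_le_add hE1 hE2) hE3

end CubicSum
end Literature.NumberTheory.LFunctions
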